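import Summits.BirchSwinnertonDyer.BirchSwinnertonDyer.Theorems.TwoAdicConverseGoodOrdinaryTwistFamily
import Summits.BirchSwinnertonDyer.BirchSwinnertonDyer.Theorems.TwoAdicConverseLambdaHalfDefs
import Summits.BirchSwinnertonDyer.BirchSwinnertonDyer.Theorems.ByReductionTypeAtTwoTorsionEulerCharH46IntegralTorsion
import Literature.NumberTheory.EllipticCurves.AnomalousOfRationalTorsionProofs
import HarnessLib

set_option linter.dupNamespace false -- `…BirchSwinnertonDyer.BirchSwinnertonDyer…` is the cell's nested layout (D-0017)
set_option autoImplicit false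

/-!
# Route `TwoAdicConverse` (rung S3), item 19218 `GoodOrdinaryRankZeroTwoConverse`: Greenberg's Thm. 4.1 at `2` is KERNEL on
# the `E[2]`-irreducible habitat — the rank-`0` `2`-converse from the `λ`-half WITHOUT the printed fact `hGr`

Cell `bsd-2adic` (run/shared/lean/pub/bsd-2adic/), seat `bsd-2adic-conv-1` (GEN 37; director-bsd D-0074 (A) row «find: 19218
`GoodOrdinaryRankZeroTwoConverse` from the K4 halves + typed inputs»). THEOREMS ONLY — no definition, no named fact, no instance, no
axiom, no `sorry`; `--supports stmt-BirchSwinnertonDyer-19218`. HONEST FRAMING: item 19218 (HELD parent = PUB 19167 ∧ `λ`-crux 19556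
`OrdLambdaHalfAtTwo`) stays OPEN at the `∀`-level; BSD is not proved by any of this; PARTITION (D-0054): none — RANK axis (S3);
companion formula cell X5@2 good-ord (B1·O1), sub-cells (α) `E[2]` IRREDUCIBLE (odd `#E(ℚ)_tors`) and (β) ∩ (T₁)@2; SHRINKS the displayed
PUB binder set there; closes none; nothing booked.

WHAT.  The S3 bridge files of this seat (`TwoAdicConverseGoodOrdinaryTwistFamily`, p424885; `…GoodOrdinaryPub`, p409493; the
`MuDoor`/`LambdaParityUpgrade`/`RankDoor` doors) read Greenberg, LNM 1716, Thm. 4.1 AT `p = 2` either as the PRINTED named fact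
`Greenberg1999.thm41_charValue_rankZero_anyPrime` (`hGr`) or as its per-curve display `X5.O1.TwoAdicEulerCharRankZero W 0` (`hEC`).
Seat `bsd-2adic-tower-1` (GEN 35, p742465 `TorsionEulerChar.H46LevelZero.twoAdicEulerCharRankZero_of_T1`, p745439
`…twoAdicEulerCharRankZero_of_forall_valuation_le_one`) PROVED that display modulo the per-curve side condition

  (T₁)@2  no nonzero rational `2`-power torsion point of `E` maps into the kernel of reduction `E₁(ℚ̄₂)`,

and the pen's routing word RC-505 asks consumers to feed it BY NAME.  This file is the S3 consumer:

* §1 (pure algebra over any number field `K`, any prime `p`) `p ∤ #E(K)_tors` ⟹ the only rational point whose image in `E(K̄)` is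
  `p`-power torsion is `O` (`eq_zero_of_nsmul_toGeomPoints_eq_zero_of_not_dvd_torsionOrder`); hence (T₁)@p holds VACUOUSLY when
  `p ∤ #E(ℚ)_tors`, in particular when `E[p]` is irreducible (`t1_of_not_dvd_torsionOrder`, `t1_of_hasIrreducibleModPGaloisRep`).
* §2 **`X5.O1.TwoAdicEulerCharRankZero W 0` is a THEOREM for every `W/ℚ` with odd `#E(ℚ)_tors`** — i.e. on the whole
  `E[2]`-IRREDUCIBLE habitat (α) of the cell (`twoAdicEulerCharRankZero_of_not_two_dvd_torsionOrder`,
  `twoAdicEulerCharRankZero_of_hasIrreducibleModPGaloisRep_two`): the hypothesis pair `(hEC) (htors)` displayed by the seat's (α)-doors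
  collapses to `htors` at their next touch (RC-500 (a)/(b) pattern; no file is rewritten here).
* §3 the S3 per-curve rank-`0` `2`-converse from the `λ`-half, RE-KEYED: p424885's
  `analyticRank_eq_zero_of_selmerCorank_eq_zero_of_lam_le` with the display `hEC` in place of the printed `hGr`
  (`…_of_eulerChar`), then `hEC` DISCHARGED on (α) (`…_of_not_two_dvd_torsionOrder`) and on (β) ∩ (T₁)@2 / (Int₂)
  (`…_of_T1`, `…_of_forall_valuation_le_one`).  PRINT left at `W`: modularity, Kato 17.4 (1)(2)@2; OPEN: the `λ`-half at `W`.
* §4 `∀`-closed habitat forms in the route's vocabulary: the body of item 19218 restricted to (α), resp. to (T₁)@2, follows from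
  PRINT {modularity, Kato 17.4 (1)(2)@2} and the crux `OrdLambdaHalfAtTwo` (route decl, by name) — Greenberg's Thm. 4.1 is no longer an
  input there (`goodOrdinaryRankZeroTwoConverse_oddTorsion_of_ordLambdaHalfAtTwo`, `…_T1_of_ordLambdaHalfAtTwo`).  The residual habitat
  of the printed `hGr` inside PUB 19167 is thereby (β) ∖ (T₁)@2 = «a rational `2`-power torsion point in `Ê(2ℤ₂)`» (tower-1's B6 rows).

References: [GreenbergLNM1716] Thm. 4.1 (p. 102), §4 Lemmas 4.6–4.7 (pp. 105–108); [SilvermanAEC2009] VII.3.1, VIII.§1;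
[Kato2004Asterisque] Thm. 17.4 (1)(2) (p. 273); [MazurTateTeitelbaum1986Invent] §I.14 (14.3); [Mazur1977] Ch. III §5 (p. 157).
-/

noncomputable section

open scoped Classical MatrixGroups ModularForm NumberField

open CongruenceSubgroup WeierstrassCurve NumberField IsDedekindDomain Field
  Literature.NumberTheory.EllipticCurves Literature.NumberTheory.EllipticCurves.ModularForms
  Literature.NumberTheory.EllipticCurves.Rank1Residual Summit.BirchSwinnertonDyer.Rank1Residual.X1.MuLambda
  Summit.BirchSwinnertonDyer.Rank1Residual.X5.O1

namespace Summit.BirchSwinnertonDyer.BirchSwinnertonDyer.Theorems.TwoAdicEulerCharKernel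

/-! ## §1 (T₁)@p is vacuous when `p ∤ #E(ℚ)_tors` (pure algebra) -/

section Algebra

variable {K : Type*} [Field K] {p : ℕ}

/-- Every rational prime lies below some finite place of `K` (`p` is not a unit of `𝓞 K`: its norm is `± p^{[K:ℚ]}`). [folklore] -/
theorem exists_heightOneSpectrum_natCast_mem [NumberField K] (hp : p.Prime) :
    ∃ v : HeightOneSpectrum (𝓞 K), ((p : ℕ) : 𝓞 K) ∈ v.asIdeal := by
  have hnu : ¬ IsUnit (p : 𝓞 K) := by
    intro hu
    have h := hu.map (Algebra.norm ℤ)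
    rw [show (p : 𝓞 K) = algebraMap ℤ (𝓞 K) (p : ℤ) by simp, Algebra.norm_algebraMap, isUnit_pow_iff,
      Int.isUnit_iff_natAbs_eq, Int.natAbs_natCast] at h
    · exact hp.one_lt.ne' h
    · rw [RingOfIntegers.rank]; exact Module.finrank_pos.ne'
  obtain ⟨M, hM, hpM⟩ := Ideal.exists_le_maximal (Ideal.span {(p : 𝓞 K)})
    (fun h => hnu (Ideal.span_singleton_eq_top.1 h))
  have hMbot : M ≠ ⊥ := by
    intro h
    rw [h, le_bot_iff, Ideal.span_singleton_eq_bot] at hpM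
    exact hp.ne_zero (by exact_mod_cast hpM)
  exact ⟨⟨M, hM.isPrime, hMbot⟩, hpM (Ideal.mem_span_singleton_self _)⟩

variable (W : WeierstrassCurve K)

/-- **`p ∤ #E(K)_tors` ⟹ no nonzero rational point is `p`-power torsion in `E(K̄)`.**  If `p^t · ι(P) = O` in `E(K̄)` for the
inclusion `ι : E(K) ↪ E(K̄)` then `p^t · P = O` (injectivity), so the order of `P ∈ E(K)_tors` divides both `p^t` and
`#E(K)_tors` (as a `Nat.card`; any field `K`); with `p ∤ #E(K)_tors` it is `1`. [cite: SilvermanAEC2009, VIII.§1 and VII.3 (torsion subgroup)] -/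
theorem eq_zero_of_nsmul_toGeomPoints_eq_zero_of_not_dvd_torsionOrder (hp : p.Prime) (htors : ¬ p ∣ W.torsionOrder)
    (P : W.toAffine.Point) (hP : ∃ t : ℕ, p ^ t • toGeomPoints W P = 0) : P = 0 := by
  obtain ⟨t, ht⟩ := hP
  have h1 : p ^ t • P = 0 := toGeomPoints_injective W (by rw [map_nsmul, map_zero]; exact ht)
  have hdvd₂ : addOrderOf P ∣ p ^ t := addOrderOf_dvd_of_nsmul_eq_zero h1
  have hfin : IsOfFinAddOrder P := isOfFinAddOrder_iff_nsmul_eq_zero.mpr ⟨p ^ t, pow_pos hp.pos t, h1⟩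
  have hdvd₁ : addOrderOf P ∣ W.torsionOrder := by
    have h := addOrderOf_dvd_natCard (⟨P, hfin⟩ : AddCommGroup.torsion W.toAffine.Point)
    rw [← AddSubgroup.addOrderOf_coe] at h
    exact h
  obtain ⟨k, -, hk⟩ := (Nat.dvd_prime_pow hp).mp hdvd₂
  rcases k with _ | k
  · rw [pow_zero] at hk
    exact AddMonoid.addOrderOf_eq_one_iff.mp hk
  · exact absurd ((dvd_pow_self p (Nat.succ_ne_zero k)).trans (hk ▸ hdvd₁)) htors

end Algebra

section T1

variable (W : WeierstrassCurve ℚ) (p : ℕ) [hp : Fact p.Prime] (vp : HeightOneSpectrum (𝓞 ℚ))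

/-- **(T₁)@p holds vacuously when `p ∤ #E(ℚ)_tors`**: tower-1's rational-point reduction `t1_of_ratPoints` fed with §1 — the
kernel-of-reduction clause is not even read. [cite: SilvermanAEC2009, VIII.§1, Prop. VII.3.1] -/
theorem t1_of_not_dvd_torsionOrder (htors : ¬ p ∣ W.torsionOrder) :
    ∀ P : W.geomPoints, (∀ σ : absoluteGaloisGroup ℚ, σ • P = P) → (∃ t : ℕ, p ^ t • P = 0) →
      pointsMap W (vp.adicCompletion ℚ) P ∈ W.localKernelOfReduction vp → P = 0 :=
  TorsionEulerChar.H46LevelZero.t1_of_ratPoints W p vp fun P hP _ =>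
    eq_zero_of_nsmul_toGeomPoints_eq_zero_of_not_dvd_torsionOrder W hp.out htors P hP

/-- **(T₁)@p holds when `E[p]` is IRREDUCIBLE** (then `p ∤ #E(ℚ)_tors`: a rational point of order `p` would span a `Γ_ℚ`-stable line,
tree `not_hasIrreducibleModPGaloisRep_of_dvd_torsionOrder`). [cite: Mazur1977, Ch. III §5, p. 157] -/
theorem t1_of_hasIrreducibleModPGaloisRep [W.IsElliptic] (hirr : W.HasIrreducibleModPGaloisRep p) :
    ∀ P : W.geomPoints, (∀ σ : absoluteGaloisGroup ℚ, σ • P = P) → (∃ t : ℕ, p ^ t • P = 0) →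
      pointsMap W (vp.adicCompletion ℚ) P ∈ W.localKernelOfReduction vp → P = 0 :=
  t1_of_not_dvd_torsionOrder W p vp fun h => not_hasIrreducibleModPGaloisRep_of_dvd_torsionOrder W p h hirr

end T1

/-! ## §2 Greenberg's Thm. 4.1 display at `2` is KERNEL on the `E[2]`-irreducible habitat -/

section Display

variable (W : WeierstrassCurve ℚ) [W.IsElliptic] [W.IsGloballyMinimal]

/-- **`TwoAdicEulerCharRankZero W 0` for every `W/ℚ` with ODD `#E(ℚ)_tors`** (good ordinary at `2` is inside the display): Greenberg's
Theorem 4.1 at `p = 2` in rank `0`, `f_X(0)·#E(ℚ)(2)² = u·2^{ord₂ ∏ c_ℓ}·#Ẽ(𝔽₂)(2)²·#Sel_{2^∞}(E/ℚ)`, is a THEOREM there — tower-1's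
`twoAdicEulerCharRankZero_of_T1` (p742465) with (T₁)@2 discharged by §1.  No printed fact is read.
[cite: GreenbergLNM1716, Thm. 4.1 (p. 102), §4 Lemmas 4.6–4.7 (pp. 105–108)] [cite: SilvermanAEC2009, Prop. VII.3.1] -/
theorem twoAdicEulerCharRankZero_of_not_two_dvd_torsionOrder (htors : ¬ 2 ∣ W.torsionOrder) :
    TwoAdicEulerCharRankZero W 0 := by
  haveI : Fact (Nat.Prime 2) := ⟨Nat.prime_two⟩
  obtain ⟨v2, hv2⟩ := exists_heightOneSpectrum_natCast_mem (K := ℚ) Nat.prime_two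
  exact TorsionEulerChar.H46LevelZero.twoAdicEulerCharRankZero_of_T1 W v2 hv2 (t1_of_not_dvd_torsionOrder W 2 v2 htors)

/-- **`TwoAdicEulerCharRankZero W 0` for every `W/ℚ` with `E[2]` IRREDUCIBLE** (no rational `2`-torsion).
[cite: GreenbergLNM1716, Thm. 4.1 (p. 102)] [cite: Mazur1977, Ch. III §5, p. 157] -/
theorem twoAdicEulerCharRankZero_of_hasIrreducibleModPGaloisRep_two (hirr : W.HasIrreducibleModPGaloisRep 2) :
    TwoAdicEulerCharRankZero W 0 := by
  haveI : Fact (Nat.Prime 2) := ⟨Nat.prime_two⟩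
  exact twoAdicEulerCharRankZero_of_not_two_dvd_torsionOrder W
    fun h => not_hasIrreducibleModPGaloisRep_of_dvd_torsionOrder W 2 h hirr

/-- **`TwoAdicEulerCharRankZero W 0` under the rational-point form of (T₁)@2** (rational `2`-torsion ALLOWED: no rational `2`-power
torsion point maps into `E₁(ℚ̄₂)` at the chosen place `v2 ∋ 2`): `twoAdicEulerCharRankZero_of_T1` ∘ `t1_of_ratPoints`, the place
supplied. [cite: GreenbergLNM1716, Thm. 4.1 (p. 102), §4 Lemmas 4.6–4.7 (pp. 105–108)] -/
theorem twoAdicEulerCharRankZero_of_ratPoints_T1 (v2 : HeightOneSpectrum (𝓞 ℚ)) (hv2 : ((2 : ℕ) : 𝓞 ℚ) ∈ v2.asIdeal)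
    (hT1' : ∀ P : W.toAffine.Point, (∃ t : ℕ, 2 ^ t • toGeomPoints W P = 0) →
      pointsMap W (v2.adicCompletion ℚ) (toGeomPoints W P) ∈ W.localKernelOfReduction v2 → P = 0) :
    TwoAdicEulerCharRankZero W 0 :=
  TorsionEulerChar.H46LevelZero.twoAdicEulerCharRankZero_of_T1 W v2 hv2
    (TorsionEulerChar.H46LevelZero.t1_of_ratPoints W 2 v2 hT1')

end Display

/-! ## §3 The per-curve rank-`0` `2`-converse from the `λ`-half, Greenberg's Thm. 4.1 fed as the display / from the kernel -/

section Curve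

variable (W : WeierstrassCurve ℚ) [W.IsElliptic] [W.IsGloballyMinimal]

/-- **THE CONVERSE AT `W` FROM `λ_an ≤ λ_alg`, RE-KEYED on the display.**  `W` globally minimal, good ordinary at `2`; PRINT:
modularity (`hmod`), Kato 17.4 (1)(2)@2 at `W` (`h17`); the Euler-characteristic DISPLAY `hEC : TwoAdicEulerCharRankZero W 0` (Greenberg's
Thm. 4.1 at `2` — a THEOREM on (α) by §2, resp. under (T₁)@2); and (`hΛ`) for the cyclotomic data, the newform `f` and every dual
datum `D`: SOME nonzero integral rational multiple `L₀ ∈ Λ` of `L₂(f,α)` has `λ(L₀) ≤ λ(X)`.  Then `corank_{ℤ₂} Sel_{2^∞}(W/ℚ) = 0 ⇒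
r_an(W) = 0` (`Sel` finite ⇒ `f_X(0) ≠ 0` ⇒ `L₀(0) ≠ 0` by the pinch `constantCoeff_charGen_eq_zero_iff_of_lam_le` ⇒
`(1 − α⁻¹)²·[0]⁺_f ≠ 0` ⇒ `L(E,1) ≠ 0`).  Verbatim the proof of p424885's `analyticRank_eq_zero_of_selmerCorank_eq_zero_of_lam_le`
with `hGr` replaced by `hEC`. [cite: GreenbergLNM1716, Thm. 4.1 (p. 102) and §1 (pp. 65–66)]
[cite: MazurTateTeitelbaum1986Invent, §I.14 (14.3)] [cite: Kato2004Asterisque, Thm. 17.4 (1)(2) (p. 273)] -/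
theorem analyticRank_eq_zero_of_selmerCorank_eq_zero_of_lam_le_of_eulerChar
    (hmod : nonempty_modularParametrizationData)
    (h17 : ∀ [NeZero (W.conductorNorm ℤ)] (f : CuspForm (Gamma0 (W.conductorNorm ℤ)) 2),
      kato_divisibility_allPrimes W 2 (f := f))
    (hEC : TwoAdicEulerCharRankZero W 0) (hgo : GoodOrd W 2)
    (hΛ : ∀ (κ : ZpExtension ℚ 2) (γ : Field.absoluteGaloisGroup ℚ),
      κ.IsCyclotomic → κ.IsTopGenerator γ → IsCyclotomicVariable 2 γ →
      ∀ [NeZero (W.conductorNorm ℤ)] (f : CuspForm (Gamma0 (W.conductorNorm ℤ)) 2), IsNewformOf W f →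
      ∀ (D : W.SelmerDualData κ γ), ∃ (c : ℚ) (L₀ : IwasawaAlgebra 2), L₀ ≠ 0 ∧ iwasawaToPowerSeries 2 L₀ =
          PowerSeries.C (c : ℚ_[2]) * padicLFunction f (unitRoot W 2 : ℚ_[2]) ∧ lam L₀ ≤ D.lambda)
    (hsel : W.selmerCorank 2 = 0) : W.analyticRank = 0 := by
  have hord : IsOrdinaryAt W 2 := hgo
  have hSel : Finite (W.selmerGroupPInfty 2) :=
    (finite_selmerGroupPInfty_iff_selmerCorank_eq_zero W 2).2 hsel
  haveI : NeZero (W.conductorNorm ℤ) := ⟨(W.conductorNorm_pos_holds).ne'⟩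
  obtain ⟨Dm⟩ := hmod W
  have hf : IsNewformOf W Dm.f := Dm.isNewformOf
  obtain ⟨κ, hκ, γ, hγ, hγ'⟩ := exists_isCyclotomic_isTopGenerator_isCyclotomicVariable_holds 2
  obtain ⟨D⟩ := W.nonempty_selmerDualData_holds κ γ hγ
  haveI : Module.Finite (IwasawaAlgebra 2) D.X := D.module_finite_holds hγ
  have hX : D.IsTorsion := (h17 Dm.f κ γ hκ hγ hγ' hord hf D).1
  obtain ⟨fE, hfE⟩ := (charIdeal_isPrincipal_holds 2 D.X).principal
  have hchar : D.charIdeal = Ideal.span {fE} := hfE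
  haveI := hSel
  -- Greenberg Thm. 4.1 AT `2` (the display): `f_X(0) ≠ 0`
  obtain ⟨u, hu⟩ := hEC hord κ γ hκ hγ hγ' D hX fE hchar hSel
  rw [add_zero, zpow_natCast] at hu
  have h20 : (2 : ℚ_[2]) ≠ 0 := two_ne_zero
  have hNp0 : (Nat.card (AddCommGroup.primaryComponent
      ((integralModelInt W).map (Int.castRingHom (ZMod 2))).toAffine.Point 2) : ℚ_[2]) ≠ 0 := by
    exact_mod_cast Nat.card_pos.ne'
  have hS0 : (Nat.card (W.selmerGroupPInfty 2) : ℚ_[2]) ≠ 0 := by exact_mod_cast Nat.card_pos.ne'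
  have hfE0 : ((PowerSeries.constantCoeff fE : ℤ_[2]) : ℚ_[2]) ≠ 0 := by
    intro h0
    rw [h0, zero_mul] at hu
    exact (mul_ne_zero (mul_ne_zero (mul_ne_zero (coe_units_ne_zero 2 u)
      (pow_ne_zero _ h20)) (pow_ne_zero 2 hNp0)) hS0) hu.symm
  have hfE0' : PowerSeries.constantCoeff fE ≠ 0 := fun h0 ↦ hfE0 (by rw [h0]; simp)
  -- the `λ`-datum and the pinch: `L₀(0) ≠ 0`, hence `L₂(f,α)(0) ≠ 0`
  obtain ⟨c, L₀, hL₀0, hL₀, hlam⟩ := hΛ κ γ hκ hγ hγ' Dm.f hf D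
  have hL00 : PowerSeries.constantCoeff L₀ ≠ 0 := fun h0 =>
    hfE0' ((TwoAdicTwistConverse.constantCoeff_charGen_eq_zero_iff_of_lam_le W (h17 Dm.f) hκ hγ hγ' hord hf D
      hchar hL₀0 hL₀ hlam).mpr h0)
  have hL0 : PowerSeries.constantCoeff (padicLFunction Dm.f (unitRoot W 2 : ℚ_[2])) ≠ 0 := by
    intro h0
    apply hL00
    have h1 := congrArg PowerSeries.constantCoeff hL₀
    rw [constantCoeff_iwasawaToPowerSeries 2 L₀, map_mul, PowerSeries.constantCoeff_C, h0, mul_zero] at h1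
    exact (PadicInt.coe_eq_zero).mp h1
  -- interpolation `L₂(f,α)(0) = (1 - α⁻¹)²·[0]⁺_f`, and `L(E,1) = [0]⁺_f·Ω⁺_f`, `Ω⁺_f > 0`
  rw [constantCoeff_padicLFunction_unitRoot hord hf] at hL0
  have hs0 : ratPlusSymbol Dm.f 0 ≠ 0 := by
    intro hs
    apply hL0
    rw [hs, Rat.cast_zero, mul_zero]
  have hper : 0 < plusPeriod Dm.f := IsNewform0.plusPeriod_pos_holds hf.1 hf.coeffField_eq_bot
  refine analyticRank_eq_zero_of_entireLFunction_one_ne_zero W ?_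
  rw [hf.entireLFunction_one_eq]
  have hre : ((ratPlusSymbol Dm.f 0 : ℚ) : ℝ) * plusPeriod Dm.f ≠ 0 :=
    mul_ne_zero (by exact_mod_cast hs0) hper.ne'
  exact_mod_cast hre

/-- **The converse at `W` from the LEAF `LambdaHalfAtTwo W` and the display** (the leaf's `IsOrdinaryAt` guard discharged by
`GoodOrd W 2`). [cite: GreenbergVatsal2000, p. 4 (after Thm. (1.2)) (shape; p odd)] [cite: GreenbergLNM1716, Thm. 4.1 (p. 102)] -/
theorem analyticRank_eq_zero_of_selmerCorank_eq_zero_of_lambdaHalf_of_eulerChar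
    (hmod : nonempty_modularParametrizationData)
    (h17 : ∀ [NeZero (W.conductorNorm ℤ)] (f : CuspForm (Gamma0 (W.conductorNorm ℤ)) 2),
      kato_divisibility_allPrimes W 2 (f := f))
    (hEC : TwoAdicEulerCharRankZero W 0) (hgo : GoodOrd W 2) (hΛ : TwoAdicTwistConverse.LambdaHalfAtTwo W)
    (hsel : W.selmerCorank 2 = 0) : W.analyticRank = 0 :=
  analyticRank_eq_zero_of_selmerCorank_eq_zero_of_lam_le_of_eulerChar W hmod h17 hEC hgo
    (fun κ γ hκ hγ hγ' _ f hf D => hΛ κ γ hκ hγ hγ' hgo f hf D) hsel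

/-- **THE CONVERSE AT `W` ON (α), NO GREENBERG PRINT.**  `W` globally minimal, good ordinary at `2`, ODD `#E(ℚ)_tors` (= `E[2]`
irreducible); PRINT {modularity, Kato 17.4 (1)(2)@2 at `W`}; OPEN: the `λ`-half leaf at `W`.  Then `corank Sel_{2^∞} = 0 ⇒ r_an = 0`.
Greenberg's Thm. 4.1 at `2` enters as the KERNEL theorem `twoAdicEulerCharRankZero_of_not_two_dvd_torsionOrder`.
[cite: GreenbergLNM1716, Thm. 4.1 (p. 102)] [cite: Kato2004Asterisque, Thm. 17.4 (1)(2) (p. 273)] -/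
theorem analyticRank_eq_zero_of_selmerCorank_eq_zero_of_lambdaHalf_of_not_two_dvd_torsionOrder
    (hmod : nonempty_modularParametrizationData)
    (h17 : ∀ [NeZero (W.conductorNorm ℤ)] (f : CuspForm (Gamma0 (W.conductorNorm ℤ)) 2),
      kato_divisibility_allPrimes W 2 (f := f))
    (htors : ¬ 2 ∣ W.torsionOrder) (hgo : GoodOrd W 2) (hΛ : TwoAdicTwistConverse.LambdaHalfAtTwo W)
    (hsel : W.selmerCorank 2 = 0) : W.analyticRank = 0 :=
  analyticRank_eq_zero_of_selmerCorank_eq_zero_of_lambdaHalf_of_eulerChar W hmod h17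
    (twoAdicEulerCharRankZero_of_not_two_dvd_torsionOrder W htors) hgo hΛ hsel

/-- **THE CONVERSE AT `W` FOR `E[2]` IRREDUCIBLE, NO GREENBERG PRINT** (the habitat of the S3 lines `birth`, `elliptic_shadow_two`,
`xi_dominant_klingen_two` and of the residual stub of `kato_determinant_greenberg_two`). [cite: GreenbergLNM1716, Thm. 4.1 (p. 102)]
[cite: Kato2004Asterisque, Thm. 17.4 (1)(2) (p. 273)] [cite: Mazur1977, Ch. III §5, p. 157] -/
theorem analyticRank_eq_zero_of_selmerCorank_eq_zero_of_lambdaHalf_of_irreducible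
    (hmod : nonempty_modularParametrizationData)
    (h17 : ∀ [NeZero (W.conductorNorm ℤ)] (f : CuspForm (Gamma0 (W.conductorNorm ℤ)) 2),
      kato_divisibility_allPrimes W 2 (f := f))
    (hirr : W.HasIrreducibleModPGaloisRep 2) (hgo : GoodOrd W 2) (hΛ : TwoAdicTwistConverse.LambdaHalfAtTwo W)
    (hsel : W.selmerCorank 2 = 0) : W.analyticRank = 0 :=
  analyticRank_eq_zero_of_selmerCorank_eq_zero_of_lambdaHalf_of_eulerChar W hmod h17
    (twoAdicEulerCharRankZero_of_hasIrreducibleModPGaloisRep_two W hirr) hgo hΛ hsel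

/-- **THE CONVERSE AT `W` ON (β) ∩ (T₁)@2, NO GREENBERG PRINT** — rational `2`-torsion allowed, provided no rational `2`-power torsion
point maps into `E₁(ℚ̄₂)` at the place `v2 ∋ 2` (rational-point form of (T₁)@2). [cite: GreenbergLNM1716, Thm. 4.1 (p. 102), §4 Lemmas 4.6–4.7]
[cite: Kato2004Asterisque, Thm. 17.4 (1)(2) (p. 273)] -/
theorem analyticRank_eq_zero_of_selmerCorank_eq_zero_of_lambdaHalf_of_T1
    (hmod : nonempty_modularParametrizationData)
    (h17 : ∀ [NeZero (W.conductorNorm ℤ)] (f : CuspForm (Gamma0 (W.conductorNorm ℤ)) 2),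
      kato_divisibility_allPrimes W 2 (f := f))
    (v2 : HeightOneSpectrum (𝓞 ℚ)) (hv2 : ((2 : ℕ) : 𝓞 ℚ) ∈ v2.asIdeal)
    (hT1' : ∀ P : W.toAffine.Point, (∃ t : ℕ, 2 ^ t • toGeomPoints W P = 0) →
      pointsMap W (v2.adicCompletion ℚ) (toGeomPoints W P) ∈ W.localKernelOfReduction v2 → P = 0)
    (hgo : GoodOrd W 2) (hΛ : TwoAdicTwistConverse.LambdaHalfAtTwo W)
    (hsel : W.selmerCorank 2 = 0) : W.analyticRank = 0 :=
  analyticRank_eq_zero_of_selmerCorank_eq_zero_of_lambdaHalf_of_eulerChar W hmod h17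
    (twoAdicEulerCharRankZero_of_ratPoints_T1 W v2 hv2 hT1') hgo hΛ hsel

/-- **THE CONVERSE AT `W` UNDER THE CHECKABLE CONDITION (Int₂), NO GREENBERG PRINT**: every rational affine point of the minimal
model whose image is `2`-power torsion has `2`-integral `x` (tower-1's p745439 door). [cite: GreenbergLNM1716, Thm. 4.1 (p. 102)]
[cite: SilvermanAEC2009, Prop. VII.1.3(b), Prop. VII.2.2] [cite: Kato2004Asterisque, Thm. 17.4 (1)(2) (p. 273)] -/
theorem analyticRank_eq_zero_of_selmerCorank_eq_zero_of_lambdaHalf_of_forall_valuation_le_one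
    (hmod : nonempty_modularParametrizationData)
    (h17 : ∀ [NeZero (W.conductorNorm ℤ)] (f : CuspForm (Gamma0 (W.conductorNorm ℤ)) 2),
      kato_divisibility_allPrimes W 2 (f := f))
    (v2 : HeightOneSpectrum (𝓞 ℚ)) (hv2 : ((2 : ℕ) : 𝓞 ℚ) ∈ v2.asIdeal)
    (H : ∀ (x₀ y₀ : ℚ) (h : W.toAffine.Nonsingular x₀ y₀),
      (∃ t : ℕ, 2 ^ t • toGeomPoints W (.some x₀ y₀ h) = 0) → v2.valuation ℚ x₀ ≤ 1)
    (hgo : GoodOrd W 2) (hΛ : TwoAdicTwistConverse.LambdaHalfAtTwo W)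
    (hsel : W.selmerCorank 2 = 0) : W.analyticRank = 0 :=
  analyticRank_eq_zero_of_selmerCorank_eq_zero_of_lambdaHalf_of_eulerChar W hmod h17
    (TorsionEulerChar.H46LevelZero.twoAdicEulerCharRankZero_of_forall_valuation_le_one W v2 hv2 H) hgo hΛ hsel

end Curve

/-! ## §4 `∀`-closed habitat forms in the route's vocabulary (item 19218's body on (α), resp. on (T₁)@2) -/

section Route

open Summit.BirchSwinnertonDyer.BirchSwinnertonDyer.Theses.TwoAdicConverse (OrdLambdaHalfAtTwo)

/-- **Item 19218's body ON (α) from TWO printed facts and the `λ`-crux** — Greenberg's Thm. 4.1 is NOT an input: for every non-CM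
globally minimal `W/ℚ`, good ordinary at `2`, with odd `#E(ℚ)_tors`: `corank_{ℤ₂} Sel_{2^∞} = 0 ⇒ r_an = 0`, GIVEN modularity,
Kato 17.4 (1)(2)@2 (class-wide, as in PUB 19167's first two conjuncts) and the route crux `OrdLambdaHalfAtTwo` (item 19556, by name).
A REDUCTION; the crux is open. [cite: GreenbergLNM1716, Thm. 4.1 (p. 102)] [cite: Kato2004Asterisque, Thm. 17.4 (1)(2) (p. 273)]
[cite: GreenbergVatsal2000, p. 4 (after Thm. (1.2)) (shape; p odd)] -/
theorem goodOrdinaryRankZeroTwoConverse_oddTorsion_of_ordLambdaHalfAtTwo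
    (hmod : nonempty_modularParametrizationData)
    (h17 : ∀ (W : WeierstrassCurve ℚ) [W.IsElliptic] [W.IsGloballyMinimal]
      [NeZero (W.conductorNorm ℤ)] (f : CuspForm (Gamma0 (W.conductorNorm ℤ)) 2),
      kato_divisibility_allPrimes W 2 (f := f))
    (hΛ : OrdLambdaHalfAtTwo) :
    ∀ (W : WeierstrassCurve ℚ) [W.IsElliptic] [W.IsGloballyMinimal], ¬ W.HasCM → GoodOrd W 2 →
      ¬ 2 ∣ W.torsionOrder → W.selmerCorank 2 = 0 → W.analyticRank = 0 := by
  intro W _ _ hcm hgo htors hsel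
  exact analyticRank_eq_zero_of_selmerCorank_eq_zero_of_lam_le_of_eulerChar W hmod (fun f => h17 W f)
    (twoAdicEulerCharRankZero_of_not_two_dvd_torsionOrder W htors) hgo
    (fun κ γ hκ hγ hγ' _ f hf D => hΛ W hcm hgo κ γ hκ hγ hγ' hgo f hf D) hsel

/-- **Item 19218's body FOR `E[2]` IRREDUCIBLE from TWO printed facts and the `λ`-crux** (same, habitat spelled
`W.HasIrreducibleModPGaloisRep 2`). [cite: GreenbergLNM1716, Thm. 4.1 (p. 102)] [cite: Kato2004Asterisque, Thm. 17.4 (1)(2) (p. 273)]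
[cite: Mazur1977, Ch. III §5, p. 157] -/
theorem goodOrdinaryRankZeroTwoConverse_irreducible_of_ordLambdaHalfAtTwo
    (hmod : nonempty_modularParametrizationData)
    (h17 : ∀ (W : WeierstrassCurve ℚ) [W.IsElliptic] [W.IsGloballyMinimal]
      [NeZero (W.conductorNorm ℤ)] (f : CuspForm (Gamma0 (W.conductorNorm ℤ)) 2),
      kato_divisibility_allPrimes W 2 (f := f))
    (hΛ : OrdLambdaHalfAtTwo) :
    ∀ (W : WeierstrassCurve ℚ) [W.IsElliptic] [W.IsGloballyMinimal], ¬ W.HasCM → GoodOrd W 2 →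
      W.HasIrreducibleModPGaloisRep 2 → W.selmerCorank 2 = 0 → W.analyticRank = 0 := by
  intro W _ _ hcm hgo hirr hsel
  haveI : Fact (Nat.Prime 2) := ⟨Nat.prime_two⟩
  exact goodOrdinaryRankZeroTwoConverse_oddTorsion_of_ordLambdaHalfAtTwo hmod h17 hΛ W hcm hgo
    (fun h => not_hasIrreducibleModPGaloisRep_of_dvd_torsionOrder W 2 h hirr) hsel

/-- **Item 19218's body ON (T₁)@2 from TWO printed facts and the `λ`-crux** (rational `2`-torsion allowed; rational-point form of
(T₁)@2 at a place `v2 ∋ 2` displayed per curve).  The complement — a rational `2`-power torsion point inside `Ê(2ℤ₂)` — is the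
exact residual habitat of the printed `hGr` in PUB 19167. [cite: GreenbergLNM1716, Thm. 4.1 (p. 102), §4 Lemmas 4.6–4.7 (pp. 105–108)]
[cite: Kato2004Asterisque, Thm. 17.4 (1)(2) (p. 273)] -/
theorem goodOrdinaryRankZeroTwoConverse_T1_of_ordLambdaHalfAtTwo
    (hmod : nonempty_modularParametrizationData)
    (h17 : ∀ (W : WeierstrassCurve ℚ) [W.IsElliptic] [W.IsGloballyMinimal]
      [NeZero (W.conductorNorm ℤ)] (f : CuspForm (Gamma0 (W.conductorNorm ℤ)) 2),
      kato_divisibility_allPrimes W 2 (f := f))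
    (hΛ : OrdLambdaHalfAtTwo) :
    ∀ (W : WeierstrassCurve ℚ) [W.IsElliptic] [W.IsGloballyMinimal], ¬ W.HasCM → GoodOrd W 2 →
      ∀ (v2 : HeightOneSpectrum (𝓞 ℚ)), ((2 : ℕ) : 𝓞 ℚ) ∈ v2.asIdeal →
      (∀ P : W.toAffine.Point, (∃ t : ℕ, 2 ^ t • toGeomPoints W P = 0) →
        pointsMap W (v2.adicCompletion ℚ) (toGeomPoints W P) ∈ W.localKernelOfReduction v2 → P = 0) →
      W.selmerCorank 2 = 0 → W.analyticRank = 0 := by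
  intro W _ _ hcm hgo v2 hv2 hT1' hsel
  exact analyticRank_eq_zero_of_selmerCorank_eq_zero_of_lam_le_of_eulerChar W hmod (fun f => h17 W f)
    (twoAdicEulerCharRankZero_of_ratPoints_T1 W v2 hv2 hT1') hgo
    (fun κ γ hκ hγ hγ' _ f hf D => hΛ W hcm hgo κ γ hκ hγ hγ' hgo f hf D) hsel

end Route

end Summit.BirchSwinnertonDyer.BirchSwinnertonDyer.Theorems.TwoAdicEulerCharKernel

end
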